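import Literature.Analysis.FluidPDE.HardSphereCollisionIntensity
import HarnessLib

/-!
# Collision intensity against a velocity-dominated density

Transfer of the finite collision intensity of the hard-sphere flow on `(T^d × ℝ^d)^N`
(`HardSphereCollisionIntensity`, energy shells) to measures with a density that decays with the
largest speed — the form needed for (local) Gibbs / Maxwellian laws, whose densities are bounded
on velocity annuli by a summable sequence:

* `configEnergy_le_of_mem_velBall` — the velocity ball of radius `V` lies in the energy shell
  `E ≤ (√N V)²/2`;
* `lintegral_collisionCount_mul_le_tsum` — if `F ≤ g n` on the `n`-th velocity annulus
  `{n < max ‖v_i‖ ≤ n + 1}` (the `0`-th being the unit velocity ball), then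
  `∫⁻_{D} #coll(z,[0,t]) F(z) dz ≤ (∑' n, g n · C(N, d, √N (n+1))) · t` with the intensity constant
  `C(N, d, V) = N² (2 d V vol B₁) vol(B̄_V)^N` of `lintegral_collisionCount_shell_le`.

Integrability of the collision count under a Gibbs-type law `F dz` is thereby reduced to the
summability of `g n · C(N, d, √N (n+1))` (Gaussian `g` against polynomial `C`), a static estimate
(Cercignani–Illner–Pulvirenti 1994 §4.2, App. 4.A; Gallagher–Saint-Raymond–Texier 2013, proof of
Prop. 4.1.1).

## References

* C. Cercignani, R. Illner, M. Pulvirenti, *The Mathematical Theory of Dilute Gases*, Springer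
  (1994), §4.2, App. 4.A pp. 107–111.
* I. Gallagher, L. Saint-Raymond, B. Texier, *From Newton to Boltzmann: hard spheres and
  short-range potentials*, EMS (2013), arXiv:1208.5753, §4.1, proof of Prop. 4.1.1 (p. 19).
-/

open Set Filter Topology Function MeasureTheory Metric
open scoped ENNReal

namespace Literature.Analysis.FluidPDE

noncomputable section

section Kinetic

namespace Alexander

variable {d : Type*} [Fintype d] {N : ℕ} {ε : ℝ}

/-- The velocity ball of radius `V` lies in the energy shell `E ≤ (√N · V)²/2`. [folklore] -/
theorem configEnergy_le_of_mem_velBall {V : ℝ} {z : Config N d (UnitAddTorus d)}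
    (hz : z ∈ velBall N d (UnitAddTorus d) V) :
    configEnergy z ≤ (Real.sqrt N * V) ^ 2 / 2 := by
  have hsum : ∑ i, ‖(z i).2‖ ^ 2 ≤ ∑ _i : Fin N, V ^ 2 :=
    Finset.sum_le_sum fun i _ => pow_le_pow_left₀ (norm_nonneg _) (hz i) 2
  rw [Finset.sum_const, Finset.card_univ, Fintype.card_fin, nsmul_eq_mul] at hsum
  rw [configEnergy, mul_pow, Real.sq_sqrt (Nat.cast_nonneg N)]
  linarith

/-- **Collision intensity against a velocity-dominated density**: if `F ≤ g n` on the `n`-th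
velocity annulus (`‖v_i‖ ≤ n + 1` for all `i`, and some `‖v_i‖ > n` when `n ≥ 1`), then
`∫⁻_{D_ε^N} #coll(z, [0, t]) · F(z) dz ≤ (∑' n, g n · C(N, d, √N (n+1))) · t`
(`0 < ε < 1/2`, `t ≥ 0`). [cite: GST2013, proof of Prop. 4.1.1 p. 19] -/
theorem lintegral_collisionCount_mul_le_tsum (hε : 0 < ε) (hε' : ε < 2⁻¹) {t : ℝ} (ht : 0 ≤ t)
    {F : Config N d (UnitAddTorus d) → ℝ≥0∞} {g : ℕ → ℝ≥0∞}
    (hF : ∀ (n : ℕ) (z : Config N d (UnitAddTorus d)), z ∈ velBall N d (UnitAddTorus d) ((n : ℝ) + 1) →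
      (1 ≤ n → z ∉ velBall N d (UnitAddTorus d) n) → F z ≤ g n) :
    ∫⁻ z in hardSphereDomain (Torus.geometry d) N ε,
        (collisionCount (Torus.geometry d) ε z t : ℝ≥0∞) * F z ∂volume ≤
      (∑' n : ℕ, g n * ((N : ℝ≥0∞) ^ 2 *
        (ENNReal.ofReal (Fintype.card d * (2 * (Real.sqrt N * ((n : ℝ) + 1)))) *
          volume (Metric.ball (0 : EuclideanSpace ℝ d) 1) *
            volume (Metric.closedBall (0 : EuclideanSpace ℝ d) (Real.sqrt N * ((n : ℝ) + 1))) ^ N))) *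
        ENNReal.ofReal t := by
  have hG := Torus.isHardSphereRegular_geometry (d := d) hε'
  have hGm : (Torus.geometry d).IsMeasurable := Torus.isMeasurable_geometry
  have hmeas : Measurable fun z : Config N d (UnitAddTorus d) =>
      (collisionCount (Torus.geometry d) ε z t : ℝ≥0∞) :=
    (measurable_from_nat (f := fun n : ℕ => (n : ℝ≥0∞))).comp (measurable_collisionCount hG hGm t)
  have hD : MeasurableSet (hardSphereDomain (Torus.geometry d) N ε) :=
    measurableSet_hardSphereDomain _ Torus.measurable_geometry_sepVec N ε
  -- the velocity annuli
  set T : ℕ → Set (Config N d (UnitAddTorus d)) := fun n =>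
    {z | z ∈ velBall N d (UnitAddTorus d) ((n : ℝ) + 1) ∧ (1 ≤ n → z ∉ velBall N d (UnitAddTorus d) n)}
    with hT_def
  have hTm : ∀ n, MeasurableSet (T n) := fun n =>
    measurableSet_setOf.2 ((measurableSet_setOf.1 (measurableSet_velBall _)).and
      (measurable_const.imp (measurableSet_setOf.1 (measurableSet_velBall _)).not))
  have hcover : hardSphereDomain (Torus.geometry d) N ε ⊆ ⋃ n, hardSphereDomain (Torus.geometry d) N ε ∩ T n := by
    classical
    intro z hz
    have hex : ∃ n : ℕ, z ∈ velBall N d (UnitAddTorus d) n := exists_mem_velBall_nat z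
    refine mem_iUnion.2 ⟨Nat.find hex - 1, hz, ?_, fun h1 => ?_⟩
    · have hm : z ∈ velBall N d (UnitAddTorus d) (Nat.find hex : ℕ) := Nat.find_spec hex
      refine fun i => (hm i).trans ?_
      have : ((Nat.find hex : ℕ) : ℝ) ≤ ((Nat.find hex - 1 : ℕ) : ℝ) + 1 := by
        rw [← Nat.cast_succ]; exact_mod_cast (Nat.le_succ_of_pred_le le_rfl)
      exact this
    · exact Nat.find_min hex (by omega)
  -- the shell bound on each annulus
  have hshell : ∀ n : ℕ, ∫⁻ z in hardSphereDomain (Torus.geometry d) N ε ∩ T n,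
      (collisionCount (Torus.geometry d) ε z t : ℝ≥0∞) * F z ∂volume ≤
        g n * ((N : ℝ≥0∞) ^ 2 *
          (ENNReal.ofReal (Fintype.card d * (2 * (Real.sqrt N * ((n : ℝ) + 1)))) *
            volume (Metric.ball (0 : EuclideanSpace ℝ d) 1) *
              volume (Metric.closedBall (0 : EuclideanSpace ℝ d) (Real.sqrt N * ((n : ℝ) + 1))) ^ N) *
          ENNReal.ofReal t) := by
    intro n
    have hV0 : 0 ≤ Real.sqrt N * ((n : ℝ) + 1) := by positivity
    calc ∫⁻ z in hardSphereDomain (Torus.geometry d) N ε ∩ T n,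
          (collisionCount (Torus.geometry d) ε z t : ℝ≥0∞) * F z ∂volume
        ≤ ∫⁻ z in hardSphereDomain (Torus.geometry d) N ε ∩ T n,
            g n * (collisionCount (Torus.geometry d) ε z t : ℝ≥0∞) ∂volume := by
          refine setLIntegral_mono' (hD.inter (hTm n)) fun z hz => ?_
          rw [mul_comm]
          exact mul_le_mul_left (hF n z hz.2.1 hz.2.2) _
      _ = g n * ∫⁻ z in hardSphereDomain (Torus.geometry d) N ε ∩ T n,
            (collisionCount (Torus.geometry d) ε z t : ℝ≥0∞) ∂volume := lintegral_const_mul _ hmeas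
      _ ≤ g n * ∫⁻ z in {z | z ∈ hardSphereDomain (Torus.geometry d) N ε ∧
            configEnergy z ≤ (Real.sqrt N * ((n : ℝ) + 1)) ^ 2 / 2},
            (collisionCount (Torus.geometry d) ε z t : ℝ≥0∞) ∂volume := by
          gcongr
          intro z hz
          exact ⟨hz.1, configEnergy_le_of_mem_velBall hz.2.1⟩
      _ ≤ _ := by
          gcongr
          exact lintegral_collisionCount_shell_le hε hε' hV0 ht
  calc ∫⁻ z in hardSphereDomain (Torus.geometry d) N ε,
        (collisionCount (Torus.geometry d) ε z t : ℝ≥0∞) * F z ∂volume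
      ≤ ∫⁻ z in ⋃ n, hardSphereDomain (Torus.geometry d) N ε ∩ T n,
          (collisionCount (Torus.geometry d) ε z t : ℝ≥0∞) * F z ∂volume := lintegral_mono_set hcover
    _ ≤ ∑' n, ∫⁻ z in hardSphereDomain (Torus.geometry d) N ε ∩ T n,
          (collisionCount (Torus.geometry d) ε z t : ℝ≥0∞) * F z ∂volume := lintegral_iUnion_le _ _
    _ ≤ ∑' n : ℕ, g n * ((N : ℝ≥0∞) ^ 2 *
          (ENNReal.ofReal (Fintype.card d * (2 * (Real.sqrt N * ((n : ℝ) + 1)))) *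
            volume (Metric.ball (0 : EuclideanSpace ℝ d) 1) *
              volume (Metric.closedBall (0 : EuclideanSpace ℝ d) (Real.sqrt N * ((n : ℝ) + 1))) ^ N) *
          ENNReal.ofReal t) := ENNReal.tsum_le_tsum hshell
    _ = _ := by rw [← ENNReal.tsum_mul_right]; refine tsum_congr fun n => ?_; ring

/-- **Collision count against a velocity-dominated density, `withDensity` form**: for the measure
`F · dZ|_{D_ε^N}` (e.g. a Gibbs law), `∫⁻ #coll(z,[0,t]) d(F · liouville) ≤ (∑' n, g n C_n) · t`.
[cite: GST2013, proof of Prop. 4.1.1 p. 19] -/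
theorem lintegral_collisionCount_withDensity_liouville_le (hε : 0 < ε) (hε' : ε < 2⁻¹) {t : ℝ}
    (ht : 0 ≤ t) {F : Config N d (UnitAddTorus d) → ℝ≥0∞} (hFm : Measurable F) {g : ℕ → ℝ≥0∞}
    (hF : ∀ (n : ℕ) (z : Config N d (UnitAddTorus d)), z ∈ velBall N d (UnitAddTorus d) ((n : ℝ) + 1) →
      (1 ≤ n → z ∉ velBall N d (UnitAddTorus d) n) → F z ≤ g n) :
    ∫⁻ z, (collisionCount (Torus.geometry d) ε z t : ℝ≥0∞)
        ∂((liouville (Torus.geometry d) N ε).withDensity F) ≤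
      (∑' n : ℕ, g n * ((N : ℝ≥0∞) ^ 2 *
        (ENNReal.ofReal (Fintype.card d * (2 * (Real.sqrt N * ((n : ℝ) + 1)))) *
          volume (Metric.ball (0 : EuclideanSpace ℝ d) 1) *
            volume (Metric.closedBall (0 : EuclideanSpace ℝ d) (Real.sqrt N * ((n : ℝ) + 1))) ^ N))) *
        ENNReal.ofReal t := by
  have hG := Torus.isHardSphereRegular_geometry (d := d) hε'
  have hGm : (Torus.geometry d).IsMeasurable := Torus.isMeasurable_geometry
  have hmeas : Measurable fun z : Config N d (UnitAddTorus d) =>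
      (collisionCount (Torus.geometry d) ε z t : ℝ≥0∞) :=
    (measurable_from_nat (f := fun n : ℕ => (n : ℝ≥0∞))).comp (measurable_collisionCount hG hGm t)
  rw [lintegral_withDensity_eq_lintegral_mul _ hFm hmeas, liouville_eq]
  refine (lintegral_congr fun z => ?_).trans_le (lintegral_collisionCount_mul_le_tsum hε hε' ht hF)
  simp only [Pi.mul_apply]
  exact mul_comm _ _

end Alexander

end Kinetic

end

end Literature.Analysis.FluidPDE
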